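import Mathlib
import Summits.ResolutionOfSingularities.ResolutionOfSingularities.Theorems.RadicialJungCleanModelsCleanSeqExtension
import Summits.ResolutionOfSingularities.ResolutionOfSingularities.Theorems.RadicialJungCleanModelsCleanPermissibleSeqComp
import HarnessLib

/-!
# Route `RadicialJung`, crux `CleanModels` (stmt-ResolutionOfSingularities-15917), line `Sketch` rev 35, stub 6 `stub_cleanProp44` (X44c):
# CLEAN PATCHING III — the conclusion of X44c may be proved PIECE BY PIECE on opens around disjoint parts of `{ord ≥ μ}`

Work item (W1) «clean patching» of the memo `Cruxes/CleanModels/Lines/Sketch-memo-4e-cleanPermissible.md` §7, third file: the clean twins of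
✓ `CampaignW46.OrderReducible.transport_piece / of_opens_finite / of_finite_of_forall_nhds` (`…GammaFreeGlobalPatchingFinite.lean`) and of the
assembly's ✓ `CP2008Prop44.orderReducible_of_pieces` (`…Prop44Assembly.lean`), in the output currency of X44c
(«`∃ X' π _ _ J', IsCleanPermissibleSeq p π J μ J' G ∧ ∀ x, idealOrder J' x < μ`», spelled out — no new definition).

* `IsCleanPermissibleSeq.isLocallyNoetherian_and_isProper` — the top of a clean-permissible sequence over a locally Noetherian base is locally
  Noetherian and proper over it (so the composite is SURJECTIVE, Mathlib `Surjective.of_universallyClosed_of_isDominant`).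
* `exists_isCleanPermissibleSeq_lt_transport_piece` — after a relative round over a piece `Z₀` (✓ `…CleanSeqExtension`), the conclusion of X44c
  on an open `V ⊆ X ∖ Z₀` transports to `Φ⁻¹ V` (✓ `exists_isCleanPermissibleSeq_lt_of_isOpenImmersion` along `Φ ∣_ V`).
* `exists_isCleanPermissibleSeq_lt_of_opens_finite` — **FINITE CLEAN PATCHING**: `X` integral locally Noetherian, `G ∈ K(X)`, `J`, `μ`; pieces
  `(Vᵢ, Zᵢ)_{i<n}` with `Vᵢ` open, `Zᵢ ⊆ Vᵢ` closed, `Zᵢ ∩ Vⱼ = ∅` (`i ≠ j`), `{ord ≥ μ} ⊆ ⋃ Zᵢ`; if on every (non-empty) `Vᵢ` some clean-permissible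
  sequence for `(J|Vᵢ, μ)` and the line of `G|Vᵢ` brings the order below `μ`, then some clean-permissible sequence for `(J, μ)` and the line of
  `G` does so on `X` (round on piece `0` by the relative extension, transport of the other pieces, induction on `n`, composition
  ✓ `IsCleanPermissibleSeq.comp`).
* `exists_isCleanPermissibleSeq_lt_of_pieces` — the form over a TIDY stage: finitely many pairwise disjoint closed pieces covering `{ord ≥ μ}`,
  each settled relative to the complement of the others (the clean twin of `orderReducible_of_pieces`, the shape consumed by a clean re-threading
  of `cossartPiltant2008_prop44_holds`).
* `exists_isCleanPermissibleSeq_lt_of_finite_of_forall_nhds` — pointwise-local form when `{ord ≥ μ}` is a finite set of closed points.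

Honest framing: OURS (glue, any dimension); nothing here proves X44c, any case of `CleanModels`, or resolution of singularities in characteristic `p`.
-/

noncomputable section

set_option linter.dupNamespace false -- mandated namespace of this single-conjunct summit

open CategoryTheory CategoryTheory.Limits AlgebraicGeometry TopologicalSpace IsLocalRing
open Literature.AlgebraicGeometry.Resolution Literature.AlgebraicGeometry.Motives
open Scheme.IdealSheafData

namespace Summit.ResolutionOfSingularities.ResolutionOfSingularities.Theorems.RadicialJung.CleanModels

/-! ## Stage data -/

/-- The top of a clean-permissible sequence over a locally Noetherian base is locally Noetherian and PROPER over the base (blowing ups of locally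
Noetherian schemes are proper, ✓ `IsBlowup.isProper`). [cite: GortzWedhorn2020, Prop. 13.96 (1)] -/
theorem IsCleanPermissibleSeq.isLocallyNoetherian_and_isProper {p : ℕ} :
    ∀ {X' X : Scheme.{0}} [IsIntegral X'] [IsIntegral X] {π : X' ⟶ X} [IsDominant π] {J : X.IdealSheafData} {μ : ℕ}
      {J' : X'.IdealSheafData} {G : X.functionField}, IsCleanPermissibleSeq p π J μ J' G → IsLocallyNoetherian X →
      IsLocallyNoetherian X' ∧ IsProper π := by
  intro X' X _ _ π _ J μ J' G h
  induction h with
  | nil J μ G => exact fun hN => ⟨hN, inferInstance⟩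
  | @cons X'' X' X _ _ _ τ _ π _ J μ J' G Y hπ hint hreg hY hτ hperm ih =>
    intro hN
    obtain ⟨hN', hP'⟩ := ih hN
    haveI := hN'
    haveI := hP'
    haveI : IsProper τ := hτ.isProper
    haveI : IsLocallyNoetherian X'' := LocallyOfFiniteType.isLocallyNoetherian τ
    exact ⟨inferInstance, inferInstance⟩

/-! ## Transport of a piece after a relative round -/

/-- **Transport of a piece after a relative round.**  `Φ : X₁ → X` dominant between integral locally Noetherian schemes with `(Φ⁻¹ O ↪ X₁) ≫ Φ` an
open immersion and `J₁|_{Φ⁻¹ O}` the pull-back of `J` (`O ⊆ X` open); then for every open `V ≤ O` (non-empty, with `Φ⁻¹ V` non-empty) the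
conclusion of X44c for `(J|_V, μ)` and the line of `G|_V` transports to `(J₁|_{Φ⁻¹V}, μ)` and the line of `(Φ^♯ G)|_{Φ⁻¹ V}` — along `Φ ∣_ V`, an
open immersion.  Clean twin of ✓ `CampaignW46.OrderReducible.transport_piece`. [cite: GortzWedhorn2020, Prop. 13.91 (2)] -/
theorem exists_isCleanPermissibleSeq_lt_transport_piece {p : ℕ} {X₁ X : Scheme.{0}} [IsIntegral X₁] [IsIntegral X]
    [IsLocallyNoetherian X] [IsLocallyNoetherian X₁] (Φ : X₁ ⟶ X) [IsDominant Φ] (J : X.IdealSheafData) (J₁ : X₁.IdealSheafData)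
    {μ : ℕ} (G : X.functionField) (O : X.Opens) (hopen : IsOpenImmersion ((Φ ⁻¹ᵁ O).ι ≫ Φ))
    (hJO : J₁.comap (Φ ⁻¹ᵁ O).ι = J.comap ((Φ ⁻¹ᵁ O).ι ≫ Φ)) (V : X.Opens) (hVO : V ≤ O)
    [IsIntegral ((V : X.Opens) : Scheme.{0})] [IsDominant V.ι] [IsIntegral ((Φ ⁻¹ᵁ V : X₁.Opens) : Scheme.{0})]
    [IsDominant (Φ ⁻¹ᵁ V).ι]
    (h : ∃ (V' : Scheme.{0}) (π : V' ⟶ V) (_ : IsIntegral V') (_ : IsDominant π) (K' : V'.IdealSheafData),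
      IsCleanPermissibleSeq p π (J.comap V.ι) μ K' (RatFn.functionFieldMap V.ι G) ∧ ∀ y, idealOrder K' y < μ) :
    ∃ (W' : Scheme.{0}) (π : W' ⟶ (Φ ⁻¹ᵁ V : X₁.Opens)) (_ : IsIntegral W') (_ : IsDominant π) (K' : W'.IdealSheafData),
      IsCleanPermissibleSeq p π (J₁.comap (Φ ⁻¹ᵁ V).ι) μ K' (RatFn.functionFieldMap (Φ ⁻¹ᵁ V).ι (RatFn.functionFieldMap Φ G)) ∧
      ∀ y, idealOrder K' y < μ := by
  haveI := hopen
  have hle : Φ ⁻¹ᵁ V ≤ Φ ⁻¹ᵁ O := fun x hx => hVO hx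
  have hfacV : (Φ ⁻¹ᵁ V).ι ≫ Φ = X₁.homOfLE hle ≫ ((Φ ⁻¹ᵁ O).ι ≫ Φ) := by
    rw [← Category.assoc, Scheme.homOfLE_ι]
  haveI hopenV : IsOpenImmersion ((Φ ⁻¹ᵁ V).ι ≫ Φ) := by rw [hfacV]; infer_instance
  haveI : IsOpenImmersion (Φ ∣_ V) := by
    have h1 : IsOpenImmersion ((Φ ∣_ V) ≫ V.ι) := by rw [morphismRestrict_ι]; exact hopenV
    exact IsOpenImmersion.of_comp (Φ ∣_ V) V.ι
  haveI : IsDominant (Φ ∣_ V) := isDominant_of_isOpenImmersion _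
  haveI : IsLocallyNoetherian ((V : X.Opens) : Scheme.{0}) := LocallyOfFiniteType.isLocallyNoetherian V.ι
  have hJV : J₁.comap (Φ ⁻¹ᵁ V).ι = J.comap ((Φ ⁻¹ᵁ V).ι ≫ Φ) := by
    rw [hfacV, Scheme.IdealSheafData.comap_comp, ← hJO, ← Scheme.IdealSheafData.comap_comp, Scheme.homOfLE_ι]
  obtain ⟨W', π, hW', hπ, K', hseq, hlt⟩ := exists_isCleanPermissibleSeq_lt_of_isOpenImmersion (Φ ∣_ V) h
  refine ⟨W', π, hW', hπ, K', ?_, hlt⟩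
  have hJ' : (J.comap V.ι).comap (Φ ∣_ V) = J₁.comap (Φ ⁻¹ᵁ V).ι := by
    rw [← Scheme.IdealSheafData.comap_comp, morphismRestrict_ι, ← hJV]
  have hG' : RatFn.functionFieldMap (Φ ∣_ V) (RatFn.functionFieldMap V.ι G) =
      RatFn.functionFieldMap (Φ ⁻¹ᵁ V).ι (RatFn.functionFieldMap Φ G) := by
    rw [← RingHom.comp_apply, ← RatFn.functionFieldMap_comp,
      Picover.FunctionFieldNormalizationIn.functionFieldMap_congr (morphismRestrict_ι Φ V), RatFn.functionFieldMap_comp,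
      RingHom.comp_apply]
  rw [hJ', hG'] at hseq
  exact hseq

/-! ## Finite clean patching -/

/-- **FINITE CLEAN PATCHING.**  `X` integral locally Noetherian, `G ∈ K(X)`, `J` an ideal sheaf, `μ : ℕ`, and `n` pieces `(Vᵢ, Zᵢ)`: `Vᵢ ⊆ X`
open, `Zᵢ` closed with `Zᵢ ⊆ Vᵢ`, `Zᵢ ∩ Vⱼ = ∅` for `i ≠ j`, every point of `X` of order `≥ μ` in some `Zᵢ`.  If on every `Vᵢ` (whenever it is
non-empty, i.e. integral with `Vᵢ ↪ X` dominant) some clean-permissible sequence for `(J|_{Vᵢ}, μ)` and the line of `G|_{Vᵢ}` brings the order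
below `μ`, then some clean-permissible sequence for `(J, μ)` and the line of `G` brings the order below `μ` on `X`.  Clean twin of
✓ `CampaignW46.OrderReducible.of_opens_finite`. [cite: Piltant2013, Prop. 5.1 (proof, Step 2)] -/
theorem exists_isCleanPermissibleSeq_lt_of_opens_finite {p : ℕ} :
    ∀ (n : ℕ) {X : Scheme.{0}} [IsIntegral X] [IsLocallyNoetherian X] (J : X.IdealSheafData) (μ : ℕ) (G : X.functionField)
      (V : Fin n → X.Opens) (Z : Fin n → Set X), (∀ i, IsClosed (Z i)) → (∀ i, Z i ⊆ (V i : Set X)) →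
      (∀ i j, i ≠ j → Disjoint (Z i) (V j : Set X)) →
      (∀ x : X, (μ : ℕ∞) ≤ idealOrder J x → ∃ i, x ∈ Z i) →
      (∀ i, ∀ [IsIntegral ((V i : X.Opens) : Scheme.{0})] [IsDominant (V i).ι],
        ∃ (V' : Scheme.{0}) (π : V' ⟶ V i) (_ : IsIntegral V') (_ : IsDominant π) (K' : V'.IdealSheafData),
          IsCleanPermissibleSeq p π (J.comap (V i).ι) μ K' (RatFn.functionFieldMap (V i).ι G) ∧ ∀ y, idealOrder K' y < μ) →
      ∃ (X' : Scheme.{0}) (Φ : X' ⟶ X) (_ : IsIntegral X') (_ : IsDominant Φ) (J' : X'.IdealSheafData),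
        IsCleanPermissibleSeq p Φ J μ J' G ∧ ∀ x, idealOrder J' x < μ := by
  intro n
  induction n with
  | zero =>
    intro X _ _ J μ G V Z hZc hZV hdisj hJZ hV
    refine ⟨X, 𝟙 X, inferInstance, inferInstance, J, IsCleanPermissibleSeq.nil J μ G, fun x => ?_⟩
    by_contra hge
    rw [not_lt] at hge
    obtain ⟨i, -⟩ := hJZ x hge
    exact Fin.elim0 i
  | succ n ih =>
    intro X _ _ J μ G V Z hZc hZV hdisj hJZ hV
    by_cases hZ0 : (Z 0).Nonempty
    swap
    · -- empty first piece: drop it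
      rw [Set.not_nonempty_iff_eq_empty] at hZ0
      exact ih J μ G (fun i => V i.succ) (fun i => Z i.succ) (fun i => hZc i.succ) (fun i => hZV i.succ)
        (fun i j hij => hdisj i.succ j.succ fun h => hij (Fin.succ_injective _ h))
        (fun x hx => by
          obtain ⟨i, hi⟩ := hJZ x hx
          have hi0 : i ≠ 0 := by
            rintro rfl
            rw [hZ0] at hi
            exact hi
          obtain ⟨j, rfl⟩ := Fin.exists_succ_eq.mpr hi0
          exact ⟨j, hi⟩)
        (fun i => hV i.succ)
    -- round on piece `0` (non-empty, so `V 0` is integral and `V 0 ↪ X` dominant)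
    haveI : Nonempty ((V 0 : X.Opens) : Scheme.{0}) := by
      obtain ⟨x, hx⟩ := hZ0
      exact ⟨⟨x, hZV 0 hx⟩⟩
    haveI : IsIntegral ((V 0 : X.Opens) : Scheme.{0}) := isIntegral_of_isOpenImmersion (V 0).ι
    haveI : IsDominant (V 0).ι := isDominant_of_isOpenImmersion _
    obtain ⟨V₀', σ₀, hV₀', hσ₀, K₀', hseqV₀, hltV₀⟩ := hV 0
    haveI := hV₀'
    haveI := hσ₀
    have hJZ₀ : ∀ y : ((V 0 : X.Opens) : Scheme.{0}), (μ : ℕ∞) ≤ idealOrder J ((V 0).ι y) → (V 0).ι y ∈ Z 0 := by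
      intro y hy
      obtain ⟨i, hi⟩ := hJZ _ hy
      by_cases hi0 : i = 0
      · subst hi0; exact hi
      · exact absurd y.2 (Set.disjoint_left.mp (hdisj i 0 hi0) hi)
    obtain ⟨X₁, hX₁, Φ₁, hΦ₁, J₁, u₁', hseq₁, hu₁', -, hK₁, -, hb₁, hopen₁, hJO₁, hN₁⟩ :=
      hseqV₀.exists_extension_of_isOpenImmersion_rel' J μ G (Z 0) (hZc 0) (V 0).ι hJZ₀
        (by rw [Scheme.Opens.range_ι]; exact hZV 0)
    haveI := hX₁
    haveI := hΦ₁
    haveI := hu₁'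
    haveI := hN₁
    haveI : IsProper Φ₁ := (hseq₁.isLocallyNoetherian_and_isProper inferInstance).2
    set O : X.Opens := ⟨(Z 0)ᶜ, (hZc 0).isOpen_compl⟩ with hO
    have hVO : ∀ i : Fin n, V i.succ ≤ O := fun i x hx hxZ =>
      Set.disjoint_left.mp (hdisj 0 i.succ (Fin.succ_ne_zero i).symm) hxZ hx
    -- the remaining pieces, pulled back to `X₁`
    have hred : ∃ (X' : Scheme.{0}) (Φ : X' ⟶ X₁) (_ : IsIntegral X') (_ : IsDominant Φ) (J' : X'.IdealSheafData),
        IsCleanPermissibleSeq p Φ J₁ μ J' (RatFn.functionFieldMap Φ₁ G) ∧ ∀ x, idealOrder J' x < μ := by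
      refine ih J₁ μ (RatFn.functionFieldMap Φ₁ G) (fun i => Φ₁ ⁻¹ᵁ V i.succ) (fun i => Φ₁ ⁻¹' Z i.succ)
        (fun i => (hZc i.succ).preimage Φ₁.continuous) (fun i x hx => hZV i.succ hx)
        (fun i j hij => ?_) (fun x₁ hx₁ => ?_) (fun i => ?_)
      · exact (hdisj i.succ j.succ fun h => hij (Fin.succ_injective _ h)).preimage Φ₁
      · -- points of `X₁` of order `≥ μ` lie over some `Zᵢ`, `i ≥ 1`
        by_cases hr : x₁ ∈ Set.range u₁'
        · obtain ⟨y, rfl⟩ := hr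
          have hy := hltV₀ y
          rw [hK₁, idealOrder_comap_of_etale u₁' J₁ y] at hy
          exact absurd hx₁ (not_le.mpr hy)
        · obtain ⟨hxO, hord⟩ :=
            CampaignW46.OrderReducible.idealOrder_eq_of_not_mem_range Φ₁ J J₁ u₁' (Z 0) (hZc 0) hb₁ hopen₁ hJO₁ hr
          rw [hord] at hx₁
          obtain ⟨i, hi⟩ := hJZ _ hx₁
          have hi0 : i ≠ 0 := by
            rintro rfl
            exact hxO hi
          obtain ⟨j, rfl⟩ := Fin.exists_succ_eq.mpr hi0
          exact ⟨j, hi⟩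
      · intro hint hdom
        -- then `V i.succ` is non-empty, hence integral with `V i.succ ↪ X` dominant
        haveI : Nonempty ((V i.succ : X.Opens) : Scheme.{0}) := by
          obtain ⟨x₁⟩ := (inferInstance : Nonempty ((Φ₁ ⁻¹ᵁ V i.succ : X₁.Opens) : Scheme.{0}))
          exact ⟨⟨Φ₁ x₁.1, x₁.2⟩⟩
        haveI : IsIntegral ((V i.succ : X.Opens) : Scheme.{0}) := isIntegral_of_isOpenImmersion (V i.succ).ι
        haveI : IsDominant (V i.succ).ι := isDominant_of_isOpenImmersion _
        exact exists_isCleanPermissibleSeq_lt_transport_piece Φ₁ J J₁ G O hopen₁ hJO₁ (V i.succ) (hVO i) (hV i.succ)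
    obtain ⟨X', Φ, hX', hΦ, J', hseq, hlt⟩ := hred
    haveI := hX'
    haveI := hΦ
    exact ⟨X', Φ ≫ Φ₁, inferInstance, inferInstance, J', hseq₁.comp hseq rfl, hlt⟩

/-! ## Over a tidy stage: pairwise disjoint closed pieces -/

/-- **Clean patching over a tidy stage** (clean twin of ✓ `CP2008Prop44.orderReducible_of_pieces`): if `{ord ≥ μ}` is covered by finitely many
pairwise disjoint closed pieces `Zᵢ` and, for each `i`, the conclusion of X44c holds on the open `Vᵢ = X ∖ ⋃_{j ≠ i} Zⱼ` for `(J|_{Vᵢ}, μ)` and the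
line of `G|_{Vᵢ}`, then it holds on `X`. [cite: Piltant2013, Prop. 5.1 (proof, Step 2)] -/
theorem exists_isCleanPermissibleSeq_lt_of_pieces {p : ℕ} {X : Scheme.{0}} [IsIntegral X] [IsLocallyNoetherian X]
    (J : X.IdealSheafData) (μ : ℕ) (G : X.functionField) {n : ℕ} (Z : Fin n → Set X) (hZc : ∀ i, IsClosed (Z i))
    (hdisj : ∀ i j, i ≠ j → Disjoint (Z i) (Z j)) (hcov : ∀ z : X, (μ : ℕ∞) ≤ idealOrder J z → ∃ i, z ∈ Z i)
    (hpiece : ∀ i (V : X.Opens), (V : Set X) = (⋃ j ∈ {j : Fin n | j ≠ i}, Z j)ᶜ →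
      ∀ [IsIntegral ((V : X.Opens) : Scheme.{0})] [IsDominant V.ι],
      ∃ (V' : Scheme.{0}) (π : V' ⟶ V) (_ : IsIntegral V') (_ : IsDominant π) (K' : V'.IdealSheafData),
        IsCleanPermissibleSeq p π (J.comap V.ι) μ K' (RatFn.functionFieldMap V.ι G) ∧ ∀ y, idealOrder K' y < μ) :
    ∃ (X' : Scheme.{0}) (Φ : X' ⟶ X) (_ : IsIntegral X') (_ : IsDominant Φ) (J' : X'.IdealSheafData),
      IsCleanPermissibleSeq p Φ J μ J' G ∧ ∀ x, idealOrder J' x < μ := by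
  classical
  have hcl : ∀ i : Fin n, IsClosed (⋃ j ∈ {j : Fin n | j ≠ i}, Z j) := fun i =>
    (Set.toFinite _).isClosed_biUnion fun j _ => hZc j
  let V : Fin n → X.Opens := fun i => ⟨(⋃ j ∈ {j : Fin n | j ≠ i}, Z j)ᶜ, (hcl i).isOpen_compl⟩
  have hV : ∀ i, ((V i : X.Opens) : Set X) = (⋃ j ∈ {j : Fin n | j ≠ i}, Z j)ᶜ := fun i => rfl
  refine exists_isCleanPermissibleSeq_lt_of_opens_finite n J μ G V Z hZc (fun i => ?_) (fun i j hij => ?_) hcov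
    (fun i => hpiece i (V i) (hV i))
  · intro z hz
    rw [hV, Set.mem_compl_iff, Set.mem_iUnion₂]
    rintro ⟨j, hj, hzj⟩
    exact Set.disjoint_left.mp (hdisj i j (Ne.symm hj)) hz hzj
  · rw [hV]
    exact Set.disjoint_left.mpr fun z hz hzV => hzV (Set.mem_iUnion₂.mpr ⟨i, hij, hz⟩)

/-! ## Pointwise-local form -/

/-- **The conclusion of X44c is pointwise-local when `{ord ≥ μ}` is finite**: if the points of order `≥ μ` lie in a finite set `S` of closed points
and every `x ∈ S` has an open neighbourhood on which the conclusion of X44c holds (for the restricted data), then it holds on `X`.  Clean twin of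
✓ `CampaignW46.OrderReducible.of_finite_of_forall_nhds`. [cite: Piltant2013, Prop. 5.1 (proof, Step 2)] -/
theorem exists_isCleanPermissibleSeq_lt_of_finite_of_forall_nhds {p : ℕ} {X : Scheme.{0}} [IsIntegral X] [IsLocallyNoetherian X]
    (J : X.IdealSheafData) {μ : ℕ} (G : X.functionField) (S : Set X) (hS : S.Finite) (hSc : ∀ x ∈ S, IsClosed ({x} : Set X))
    (hJS : ∀ x : X, (μ : ℕ∞) ≤ idealOrder J x → x ∈ S)
    (hloc : ∀ x ∈ S, ∃ V : X.Opens, x ∈ V ∧ ∀ [IsIntegral ((V : X.Opens) : Scheme.{0})] [IsDominant V.ι],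
      ∃ (V' : Scheme.{0}) (π : V' ⟶ V) (_ : IsIntegral V') (_ : IsDominant π) (K' : V'.IdealSheafData),
        IsCleanPermissibleSeq p π (J.comap V.ι) μ K' (RatFn.functionFieldMap V.ι G) ∧ ∀ y, idealOrder K' y < μ) :
    ∃ (X' : Scheme.{0}) (Φ : X' ⟶ X) (_ : IsIntegral X') (_ : IsDominant Φ) (J' : X'.IdealSheafData),
      IsCleanPermissibleSeq p Φ J μ J' G ∧ ∀ x, idealOrder J' x < μ := by
  classical
  obtain ⟨n, f, hf⟩ := hS.fin_embedding
  have hfS : ∀ i, f i ∈ S := fun i => hf ▸ Set.mem_range_self i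
  choose V hxV hV using fun i => hloc (f i) (hfS i)
  -- shrink `V i` off the other points of `S`
  have hcl : ∀ i : Fin n, IsClosed (⋃ j ∈ {j : Fin n | j ≠ i}, ({f j} : Set X)) := fun i =>
    (Set.toFinite _).isClosed_biUnion fun j _ => hSc (f j) (hfS j)
  let W : Fin n → X.Opens := fun i =>
    ⟨(V i : Set X) \ ⋃ j ∈ {j : Fin n | j ≠ i}, ({f j} : Set X), (V i).2.sdiff (hcl i)⟩
  have hWV : ∀ i, W i ≤ V i := fun i x hx => hx.1
  have hxW : ∀ i, f i ∈ W i := by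
    intro i
    refine ⟨hxV i, ?_⟩
    simp only [Set.mem_setOf_eq, Set.mem_iUnion, Set.mem_singleton_iff, exists_prop, not_exists, not_and]
    intro j hj hij
    exact hj (f.injective hij.symm)
  have hW : ∀ i, ∀ [IsIntegral ((W i : X.Opens) : Scheme.{0})] [IsDominant (W i).ι],
      ∃ (V' : Scheme.{0}) (π : V' ⟶ W i) (_ : IsIntegral V') (_ : IsDominant π) (K' : V'.IdealSheafData),
        IsCleanPermissibleSeq p π (J.comap (W i).ι) μ K' (RatFn.functionFieldMap (W i).ι G) ∧ ∀ y, idealOrder K' y < μ := by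
    intro i _ _
    haveI : Nonempty ((V i : X.Opens) : Scheme.{0}) := ⟨⟨f i, hxV i⟩⟩
    haveI : IsIntegral ((V i : X.Opens) : Scheme.{0}) := isIntegral_of_isOpenImmersion (V i).ι
    haveI : IsDominant (V i).ι := isDominant_of_isOpenImmersion _
    haveI : IsDominant (X.homOfLE (hWV i)) := isDominant_of_isOpenImmersion _
    haveI : IsLocallyNoetherian ((V i : X.Opens) : Scheme.{0}) := LocallyOfFiniteType.isLocallyNoetherian (V i).ι
    obtain ⟨V', π, hV', hπ, K', hseq, hlt⟩ := exists_isCleanPermissibleSeq_lt_of_isOpenImmersion (X.homOfLE (hWV i)) (hV i)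
    refine ⟨V', π, hV', hπ, K', ?_, hlt⟩
    have hJ' : (J.comap (V i).ι).comap (X.homOfLE (hWV i)) = J.comap (W i).ι := by
      rw [← Scheme.IdealSheafData.comap_comp, Scheme.homOfLE_ι]
    have hG' : RatFn.functionFieldMap (X.homOfLE (hWV i)) (RatFn.functionFieldMap (V i).ι G) = RatFn.functionFieldMap (W i).ι G := by
      rw [← RingHom.comp_apply, ← RatFn.functionFieldMap_comp,
        Picover.FunctionFieldNormalizationIn.functionFieldMap_congr (X.homOfLE_ι (hWV i))]
    rw [hJ', hG'] at hseq
    exact hseq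
  refine exists_isCleanPermissibleSeq_lt_of_opens_finite n J μ G W (fun i => {f i}) (fun i => hSc (f i) (hfS i))
    (fun i => Set.singleton_subset_iff.mpr (hxW i)) (fun i j hij => ?_) (fun x hx => ?_) hW
  · rw [Set.disjoint_singleton_left]
    intro hmem
    have h2 := hmem.2
    simp only [Set.mem_setOf_eq, Set.mem_iUnion, Set.mem_singleton_iff, exists_prop, not_exists, not_and] at h2
    exact h2 i hij rfl
  · have hxS := hJS x hx
    rw [← hf] at hxS
    obtain ⟨i, rfl⟩ := hxS
    exact ⟨i, rfl⟩

end Summit.ResolutionOfSingularities.ResolutionOfSingularities.Theorems.RadicialJung.CleanModels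

end
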